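import Summits.ABC.ABC.Theorems.IneffectiveSubspaceTowerFourSubLiouvilleStubTransfer
import Summits.ABC.ABC.Theorems.IneffectiveSubspaceTowerFourSubLiouvilleStubFixedFormsRoth
import Summits.ABC.ABC.Theorems.IneffectiveSubspaceTowerFourSubLiouvilleConverse

/-!
# The crux `TowerFourSubLiouville` is EQUIVALENT to its residual core (line `fourth-radical-binomial-thue`)

Helper (`--supports`) for the crux `Summit.ABC.ABC.Theses.IneffectiveSubspace.TowerFourSubLiouville`
(stmt-ABC-1649), line `fourth-radical-binomial-thue` (lead prover-line-stmt-ABC-1649-0, 2026-08-16).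

With the transfer (`stub_transfer`, landed), the Roth stratum (`stub_fixedFormsRoth`, landed: every FINITE box of
binomial quartic forms `max(v,w) ≤ H` has every saving `η < 2`, by Thue–Siegel–Roth per form) and the converse
(`stub_cruxGivesUBQ`, landed) in the tree, this file records the upshot as ONE theorem,
`towerFourSubLiouville_iff_core`: the crux `∃ A < 2, TowerIneq(4, A)` holds IF AND ONLY IF the line's core
statement holds —

  `∃ η > 0, ∃ H Z₀, ∀ v w Y Z, Z₀ ≤ Z → H < max v w → v, w fourth-power-free → v, w, Y > 0 → gcd(vY, wZ) = 1 →
     max(v,w) ≤ Z^η → wZ⁴ ≠ vY⁴ → |wZ⁴ − vY⁴| > Z^η`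

(verbatim the registered stub `stub_genericFormsSaving`): a polynomially-uniform power saving over Liouville's
`|wZ⁴ − vY⁴| ≥ 1` for the fourth-power-free binomial quartic family off some finite box of coefficients.  So the
residual of the line is not a convenient sufficient condition but the crux itself in Thue coordinates; any proof
of the crux, by any route, proves this statement (and conversely).

Direction `←` is the line's composition (`TowerFourSubLiouville_of` of the skeleton, made unconditional in its
first two hypotheses): shrink `η ↦ min η 1`, reduce a coefficient pair to its fourth-power-free parts
`v = v₀s⁴, w = w₀t⁴` (the quadruple `(v₀, w₀, sY, tZ)` is again admissible, with the same value `wZ⁴ − vY⁴`),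
split on `max(v₀,w₀) ≤ H` (Roth stratum) / `> H` (core), and feed the resulting uniform saving to the transfer.
Direction `→` is the converse with `H := 0`.  The statements are kept unfolded (no auxiliary `def`s), matching the
registered signatures character for character.
-/

-- `Summit.ABC.ABC` is the mandated summit-side namespace (CONVENTIONS §2); the duplicate is deliberate.
set_option linter.dupNamespace false

namespace Summit.ABC.ABC.Theorems.TowerFourSubLiouville

open scoped BigOperators
open Summit.ABC.ABC.Theses.IneffectiveSubspace

/-- Monotonicity of the saving in `η` (for `Z ≥ 1`): a larger saving implies a smaller one. -/
theorem coreIff_saving_mono {η η' : ℝ} (hle : η' ≤ η) {v w Y Z : ℕ} (hZ : 1 ≤ Z)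
    (h : 0 < v → 0 < w → 0 < Y → Nat.Coprime (v * Y) (w * Z) → ((max v w : ℕ) : ℝ) ≤ (Z : ℝ) ^ η →
      w * Z ^ 4 ≠ v * Y ^ 4 → (Z : ℝ) ^ η < |((w * Z ^ 4 : ℕ) : ℝ) - ((v * Y ^ 4 : ℕ) : ℝ)|) :
    0 < v → 0 < w → 0 < Y → Nat.Coprime (v * Y) (w * Z) → ((max v w : ℕ) : ℝ) ≤ (Z : ℝ) ^ η' →
      w * Z ^ 4 ≠ v * Y ^ 4 → (Z : ℝ) ^ η' < |((w * Z ^ 4 : ℕ) : ℝ) - ((v * Y ^ 4 : ℕ) : ℝ)| := by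
  intro hv hw hY hcop hmax hne
  have hZ1 : (1 : ℝ) ≤ (Z : ℝ) := by exact_mod_cast hZ
  have hmono : (Z : ℝ) ^ η' ≤ (Z : ℝ) ^ η := Real.rpow_le_rpow_of_exponent_le hZ1 hle
  exact lt_of_le_of_lt hmono (h hv hw hY hcop (hmax.trans hmono) hne)

/-- Fourth-power-free decomposition: every `m > 0` is `m₀·s⁴` with `m₀` fourth-power-free. -/
theorem coreIff_exists_eq_mul_pow_four {m : ℕ} (hm : 0 < m) :
    ∃ m₀ s : ℕ, 0 < m₀ ∧ 0 < s ∧ m = m₀ * s ^ 4 ∧ ∀ t : ℕ, t ^ 4 ∣ m₀ → t = 1 := by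
  classical
  have hb : ∀ s : ℕ, s ^ 4 ∣ m → s ≤ m := by
    intro s hs
    rcases Nat.eq_zero_or_pos s with h0 | hs0
    · exfalso
      rw [h0, zero_pow (by norm_num)] at hs
      exact absurd (eq_zero_of_zero_dvd hs) hm.ne'
    · exact le_trans (Nat.le_self_pow (by norm_num) s) (Nat.le_of_dvd hm hs)
  have h1 : (1 : ℕ) ^ 4 ∣ m := by simp
  have hs4 : (Nat.findGreatest (fun s => s ^ 4 ∣ m) m) ^ 4 ∣ m :=
    Nat.findGreatest_spec (P := fun s => s ^ 4 ∣ m) hm h1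
  have hs1 : 1 ≤ Nat.findGreatest (fun s => s ^ 4 ∣ m) m :=
    Nat.le_findGreatest (P := fun s => s ^ 4 ∣ m) hm h1
  have key : ∀ t : ℕ, t ^ 4 ∣ m → t ≤ Nat.findGreatest (fun s => s ^ 4 ∣ m) m :=
    fun t ht => Nat.le_findGreatest (P := fun s => s ^ 4 ∣ m) (hb t ht) ht
  generalize hS : Nat.findGreatest (fun s => s ^ 4 ∣ m) m = s at hs4 hs1 key
  obtain ⟨m₀, hm₀⟩ := hs4
  have hm₀pos : 0 < m₀ := by
    rcases Nat.eq_zero_or_pos m₀ with h0 | h0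
    · rw [h0, mul_zero] at hm₀; omega
    · exact h0
  refine ⟨m₀, s, hm₀pos, hs1, by rw [hm₀]; ring, ?_⟩
  intro t ht
  have ht0 : 0 < t := by
    rcases Nat.eq_zero_or_pos t with h0 | h0
    · exfalso
      rw [h0, zero_pow (by norm_num)] at ht
      exact absurd (eq_zero_of_zero_dvd ht) hm₀pos.ne'
    · exact h0
  have hst : (s * t) ^ 4 ∣ m := by
    rw [hm₀, mul_pow]
    exact mul_dvd_mul_left _ ht
  have hle : s * t ≤ s * 1 := by
    rw [mul_one]
    exact key _ hst
  have ht1 : t ≤ 1 := le_of_mul_le_mul_left hle hs1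
  omega

/-- A saving for the REDUCED quadruple `(v₀, w₀, sY, tZ)` is a saving for `(v, w, Y, Z)` when `v = v₀s⁴`,
`w = w₀t⁴` (`η ≥ 0`): admissibility transfers down, the value `wZ⁴ − vY⁴` is unchanged, and `Z ≤ tZ`. -/
theorem coreIff_saving_of_reduced {η : ℝ} (hη : 0 ≤ η) {v w Y Z v₀ w₀ s t : ℕ}
    (hs : 0 < s) (ht : 0 < t) (hv : v = v₀ * s ^ 4) (hw : w = w₀ * t ^ 4)
    (h : 0 < v₀ → 0 < w₀ → 0 < s * Y → Nat.Coprime (v₀ * (s * Y)) (w₀ * (t * Z)) →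
      ((max v₀ w₀ : ℕ) : ℝ) ≤ ((t * Z : ℕ) : ℝ) ^ η → w₀ * (t * Z) ^ 4 ≠ v₀ * (s * Y) ^ 4 →
      ((t * Z : ℕ) : ℝ) ^ η < |((w₀ * (t * Z) ^ 4 : ℕ) : ℝ) - ((v₀ * (s * Y) ^ 4 : ℕ) : ℝ)|) :
    0 < v → 0 < w → 0 < Y → Nat.Coprime (v * Y) (w * Z) → ((max v w : ℕ) : ℝ) ≤ (Z : ℝ) ^ η →
      w * Z ^ 4 ≠ v * Y ^ 4 → (Z : ℝ) ^ η < |((w * Z ^ 4 : ℕ) : ℝ) - ((v * Y ^ 4 : ℕ) : ℝ)| := by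
  intro hv0 hw0 hY hcop hmax hne
  have hv₀ : 0 < v₀ := by
    rcases Nat.eq_zero_or_pos v₀ with h0 | h0
    · rw [h0, zero_mul] at hv; omega
    · exact h0
  have hw₀ : 0 < w₀ := by
    rcases Nat.eq_zero_or_pos w₀ with h0 | h0
    · rw [h0, zero_mul] at hw; omega
    · exact h0
  have hsY : 0 < s * Y := Nat.mul_pos hs hY
  have hdv : v₀ * (s * Y) ∣ v * Y := ⟨s ^ 3, by rw [hv]; ring⟩
  have hdw : w₀ * (t * Z) ∣ w * Z := ⟨t ^ 3, by rw [hw]; ring⟩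
  have hcop' : Nat.Coprime (v₀ * (s * Y)) (w₀ * (t * Z)) :=
    Nat.Coprime.coprime_dvd_right hdw (Nat.Coprime.coprime_dvd_left hdv hcop)
  have hZle : ((Z : ℕ) : ℝ) ≤ ((t * Z : ℕ) : ℝ) := Nat.cast_le.mpr (Nat.le_mul_of_pos_left Z ht)
  have hZ0 : (0 : ℝ) ≤ (Z : ℝ) := Nat.cast_nonneg Z
  have hpow : (Z : ℝ) ^ η ≤ ((t * Z : ℕ) : ℝ) ^ η := Real.rpow_le_rpow hZ0 hZle hη
  have hv₀le : v₀ ≤ v := by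
    rw [hv]; exact Nat.le_mul_of_pos_right v₀ (pow_pos hs 4)
  have hw₀le : w₀ ≤ w := by
    rw [hw]; exact Nat.le_mul_of_pos_right w₀ (pow_pos ht 4)
  have hmax' : ((max v₀ w₀ : ℕ) : ℝ) ≤ ((t * Z : ℕ) : ℝ) ^ η := by
    have h1 : ((max v₀ w₀ : ℕ) : ℝ) ≤ ((max v w : ℕ) : ℝ) := Nat.cast_le.mpr (max_le_max hv₀le hw₀le)
    exact h1.trans (hmax.trans hpow)
  have hwZ : w₀ * (t * Z) ^ 4 = w * Z ^ 4 := by rw [hw]; ring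
  have hvY : v₀ * (s * Y) ^ 4 = v * Y ^ 4 := by rw [hv]; ring
  have hne' : w₀ * (t * Z) ^ 4 ≠ v₀ * (s * Y) ^ 4 := by rwa [hwZ, hvY]
  have key := h hv₀ hw₀ hsY hcop' hmax' hne'
  rw [hwZ, hvY] at key
  exact lt_of_le_of_lt hpow key

/-- **The crux is equivalent to the line's core.**  `TowerFourSubLiouville` (`∃ A < 2, TowerIneq(4, A)`) holds iff
some saving `η > 0` holds for all fourth-power-free binomial quartic forms off some finite box (verbatim the
registered stub `stub_genericFormsSaving` of line `fourth-radical-binomial-thue`).  `←`: Roth stratum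
(`stub_fixedFormsRoth`) on the box + the core off the box, glued through the fourth-power-free reduction, then the
transfer (`stub_transfer`); `→`: the converse (`stub_cruxGivesUBQ`) with `H = 0`. -/
theorem towerFourSubLiouville_iff_core :
    TowerFourSubLiouville ↔
    (∃ η : ℝ, 0 < η ∧ ∃ H Z₀ : ℕ, ∀ v w Y Z : ℕ, Z₀ ≤ Z → H < max v w → (∀ t : ℕ, t ^ 4 ∣ v → t = 1) →
      (∀ t : ℕ, t ^ 4 ∣ w → t = 1) → 0 < v → 0 < w → 0 < Y → Nat.Coprime (v * Y) (w * Z) →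
      ((max v w : ℕ) : ℝ) ≤ (Z : ℝ) ^ η → w * Z ^ 4 ≠ v * Y ^ 4 →
      (Z : ℝ) ^ η < |((w * Z ^ 4 : ℕ) : ℝ) - ((v * Y ^ 4 : ℕ) : ℝ)|) := by
  constructor
  · intro h
    obtain ⟨η, hη, Z₀, hU⟩ := stub_cruxGivesUBQ h
    exact ⟨η, hη, 0, Z₀, fun v w Y Z hZ _ _ _ => hU v w Y Z hZ⟩
  · rintro ⟨η, hη, H, Z₀, hoff⟩
    -- shrink the saving to `η' = min η 1 < 2`
    set η' : ℝ := min η 1 with hη'def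
    have hη' : 0 < η' := lt_min hη one_pos
    have hη'2 : η' < 2 := lt_of_le_of_lt (min_le_right _ _) one_lt_two
    -- the Roth stratum on the box `max(v,w) ≤ H`
    obtain ⟨Z₁, hon⟩ := stub_fixedFormsRoth H η' hη' hη'2
    -- assemble the uniform saving `UBQ η'` beyond `max Z₀ Z₁ ⊔ 1` and feed it to the transfer
    refine stub_transfer ⟨η', hη', max (max Z₀ Z₁) 1, fun v w Y Z hZ => ?_⟩
    intro hv hw hY hcop hmax hne
    have hZ1 : 1 ≤ Z := le_trans (le_max_right _ _) hZ
    obtain ⟨v₀, s, _hv₀, hs, hvs, hvf⟩ := coreIff_exists_eq_mul_pow_four hv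
    obtain ⟨w₀, t, _hw₀, ht, hwt, hwf⟩ := coreIff_exists_eq_mul_pow_four hw
    have htZ : Z ≤ t * Z := Nat.le_mul_of_pos_left Z ht
    have hZ₀ : Z₀ ≤ t * Z := le_trans (le_trans (le_trans (le_max_left _ _) (le_max_left _ _)) hZ) htZ
    have hZ₁ : Z₁ ≤ t * Z := le_trans (le_trans (le_trans (le_max_right _ _) (le_max_left _ _)) hZ) htZ
    have htZ1 : 1 ≤ t * Z := le_trans hZ1 htZ
    have hred : 0 < v₀ → 0 < w₀ → 0 < s * Y → Nat.Coprime (v₀ * (s * Y)) (w₀ * (t * Z)) →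
        ((max v₀ w₀ : ℕ) : ℝ) ≤ ((t * Z : ℕ) : ℝ) ^ η' → w₀ * (t * Z) ^ 4 ≠ v₀ * (s * Y) ^ 4 →
        ((t * Z : ℕ) : ℝ) ^ η' < |((w₀ * (t * Z) ^ 4 : ℕ) : ℝ) - ((v₀ * (s * Y) ^ 4 : ℕ) : ℝ)| := by
      rcases Nat.lt_or_ge H (max v₀ w₀) with hlt | hle
      · exact coreIff_saving_mono (min_le_left η 1) htZ1 (hoff v₀ w₀ (s * Y) (t * Z) hZ₀ hlt hvf hwf)
      · exact hon v₀ w₀ (s * Y) (t * Z) hZ₁ hle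
    exact coreIff_saving_of_reduced hη'.le hs ht hvs hwt hred hv hw hY hcop hmax hne

/-- Registered form (`stub_coreIffCrux` on stmt-ABC-1649) of `towerFourSubLiouville_iff_core`: the crux is equivalent to
the line's core stub `stub_genericFormsSaving`. -/
theorem stub_coreIffCrux : Summit.ABC.ABC.Theses.IneffectiveSubspace.TowerFourSubLiouville ↔ (∃ η : ℝ, 0 < η ∧ ∃ H Z₀ : ℕ, ∀ v w Y Z : ℕ, Z₀ ≤ Z → H < max v w → (∀ t : ℕ, t ^ 4 ∣ v → t = 1) → (∀ t : ℕ, t ^ 4 ∣ w → t = 1) → 0 < v → 0 < w → 0 < Y → Nat.Coprime (v * Y) (w * Z) → ((max v w : ℕ) : ℝ) ≤ (Z : ℝ) ^ η → w * Z ^ 4 ≠ v * Y ^ 4 → (Z : ℝ) ^ η < |((w * Z ^ 4 : ℕ) : ℝ) - ((v * Y ^ 4 : ℕ) : ℝ)|) :=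
  towerFourSubLiouville_iff_core

end Summit.ABC.ABC.Theorems.TowerFourSubLiouville
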